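import Summits.BirchSwinnertonDyer.BirchSwinnertonDyer.Theses.ByReductionTypeAtTwo
import Summits.BirchSwinnertonDyer.BirchSwinnertonDyer.Theorems.ByReductionTypeAtTwoRankOneAtTwoBigImageOddLocalOneDoorAnalyticGlue
import Summits.BirchSwinnertonDyer.BirchSwinnertonDyer.Theorems.ByReductionTypeAtTwoRankOneAtTwoBigImageOddLocalOneDoorTwinValue
import Literature.NumberTheory.EllipticCurves.HeegnerHypothesisKroneckerProofs
import Literature.NumberTheory.EllipticCurves.ModularityVersionApProofs
import HarnessLib

/-!
# Route ByReductionTypeAtTwo, crux `RankOneAtTwoBigImageOddLocal` (stmt-BirchSwinnertonDyer-23715), LINE v8 `one_door_analytic`: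
# the registered stub `stub_twinArith` BY NAME, and the crux BY NAME from PRINT + ONE conjecture + the route's rank-`0` cruxes + Manin

Lead prover seat `bsd-line-fkl-p1` g6 (2026-08-28), line of record v8 `one_door_analytic` (planner -an g11).  With the supply and
the glue tree theorems (`…OneDoorAnalyticGlue.lean`) and the kernel twist arithmetic of the width seat fkl-p2 g6
(`…OneDoorTamagawa.lean` p616165, `…OneDoorTwinValue.lean` p616880), the registered skeleton
`Cruxes/RankOneAtTwoBigImageOddLocal/Lines/one_door_analytic.lean` composes to the route crux from:

  PRINT `S_pub` (Gross–Zagier, Kolyvagin, Heegner rationality (theorem), GZK, modularity) · PRINT `S_pubHL` (modularity as a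
  newform, Hoffstein–Luo 1997) · the lens' CONJECTURE `DoorIndexLawFullAtTwo` (AN-28; the `2`-part of rank-one BSD in
  Heegner-index currency with the twin's `Ш` floating; census ENGINE L j300076 597/597) · the route's OWN four rank-`0` cruxes
  at `2` (items 19095–19098, consumed by `closes` anyway) · `S_manin` (odd parametrisation constant; open only for `4 ∣ N`).

* `stub_twinArith : DoorTwinValueAtTwoOfRankZero` — the registered kernel stub, discharged by fkl-p2's
  `doorTwinValueAtTwo_of_rankZeroTwin` (modularity out of `S_pub`).
* `rankZeroTwin_of_rankZero_cruxes` — the four route cruxes ⇒ `S_rankZeroTwin` (reduction-type exhaustion).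
* `rankOneAtTwoBigImageOddLocal_of_oneDoorAnalytic` — the crux BY NAME from the five inputs above.

BSD is not proved by any of this; the theorem is conditional by design on PRINT named facts, one conjecture and four open route items.
-/

set_option autoImplicit false

noncomputable section

open scoped Classical

set_option linter.dupNamespace false

namespace Summit.BirchSwinnertonDyer.BirchSwinnertonDyer.Theorems.RankOneAtTwoOneDoor

open WeierstrassCurve Literature.NumberTheory.EllipticCurves Literature.NumberTheory.EllipticCurves.ModularForms
  Summit.BirchSwinnertonDyer.Rank1Residual.F1Sign2
  Summit.BirchSwinnertonDyer.BirchSwinnertonDyer.Theses.ByReductionTypeAtTwo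

/-- **Registered stub `stub_twinArith` of LINE v8 (`DoorTwinValueAtTwoOfRankZero = S_pub → S_rankZeroTwin → DoorTwinValueAtTwo`),
PROVED**: modularity (`S_pub.2.2`) and the width seat's `doorTwinValueAtTwo_of_rankZeroTwin` (p616880: `T(E^{(d)})` odd, Tate `I₀*`
Tamagawa counts at the door primes, rank-`0` unpacking of `BSD(Wd, 2)`). -/
theorem stub_twinArith : DoorTwinValueAtTwoOfRankZero :=
  fun hpub hZ => doorTwinValueAtTwo_of_rankZeroTwin hpub.2.2 hZ

/-- The route's four rank-`0` cruxes at `2`, BY NAME, give rank-`0` `BSD₂` for every non-CM curve (`S_rankZeroTwin`):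
case split on the reduction type at `2` (`bsdp_two_of_rankZero_cruxes`). -/
theorem rankZeroTwin_of_rankZero_cruxes
    (hR0 : GoodOrdinaryRankZeroAtTwo ∧ MultiplicativeRankZeroAtTwo ∧ SupersingularRankZeroAtTwo ∧ AdditiveRankZeroAtTwo) :
    S_rankZeroTwin :=
  fun V _ _ hCM hr => bsdp_two_of_rankZero_cruxes hR0 V hCM hr

/-- **The crux `RankOneAtTwoBigImageOddLocal` BY NAME from LINE v8's inputs**: PRINT (`S_pub`, `S_pubHL`), the conjecture
`DoorIndexLawFullAtTwo`, the route's four rank-`0` cruxes at `2`, and `S_manin` — supply, glue and twin arithmetic being tree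
theorems.  (GZK turns `analyticRank = 1` into `mordellWeilRank = 1`.) -/
theorem rankOneAtTwoBigImageOddLocal_of_oneDoorAnalytic (hpub : S_pub) (hHL : S_pubHL) (hIdx : DoorIndexLawFullAtTwo)
    (hR0 : GoodOrdinaryRankZeroAtTwo ∧ MultiplicativeRankZeroAtTwo ∧ SupersingularRankZeroAtTwo ∧ AdditiveRankZeroAtTwo)
    (hMan : S_manin) : RankOneAtTwoBigImageOddLocal := by
  intro W _ _ hCM hsurj hT hc hr
  have hrk : W.mordellWeilRank = 1 := by
    have h := (hpub.2.1 W (le_of_eq hr)).1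
    rw [h, hr]
  exact doorGlueAn hpub hIdx (stub_twinArith hpub (rankZeroTwin_of_rankZero_cruxes hR0))
    (doorSupplyAnalyticAtTwo_of_pubHL hHL) hMan W hCM hsurj hT hc hr hrk

/-- The same with the two PRINT conjunctions opened into the tree's named facts. -/
theorem rankOneAtTwoBigImageOddLocal_of_oneDoorAnalytic_primary
    (hGZ : ∀ (N : ℕ) [NeZero N] (W : WeierstrassCurve ℚ) (K : Type) [Field K] [NumberField K], gross_zagier N W K)
    (hKo : ∀ (N : ℕ) [NeZero N] (W : WeierstrassCurve ℚ) (K : Type) [Field K] [NumberField K], kolyvagin N W K)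
    (hGZK : rank_eq_analyticRank_of_analyticRank_le_one) (hmod : WeierstrassCurve.hasEntireLFunction_rat)
    (hnf : exists_isNewformOf) (hHL : HoffsteinLuo1997_exists_twist_L_one_ne_zero)
    (hIdx : DoorIndexLawFullAtTwo)
    (hR0 : GoodOrdinaryRankZeroAtTwo ∧ MultiplicativeRankZeroAtTwo ∧ SupersingularRankZeroAtTwo ∧ AdditiveRankZeroAtTwo)
    (hMan : S_manin) : RankOneAtTwoBigImageOddLocal :=
  rankOneAtTwoBigImageOddLocal_of_oneDoorAnalytic
    ⟨fun N _ W K _ _ => ⟨hGZ N W K, hKo N W K, heegnerPointComplex_mem_range_map_holds N W K⟩, hGZK, hmod⟩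
    ⟨hnf, hHL⟩ hIdx hR0 hMan

/-! ### APPEND (lead g6): the promoted child is LOSSLESS — the crux implies AN-28 back (REF1 §85 «lossless reformulation», in the kernel) -/

/-- **`RankOneAtTwoBigImageOddLocal → DoorIndexLawFullAtTwo`, modulo PRINT (`S_pub`), rank-`0` `BSD₂` of non-CM curves
(`S_rankZeroTwin`, i.e. the route's four rank-`0` cruxes) and the PROVED twist Tamagawa arithmetic** — the converse of
`rankOneAtTwoBigImageOddLocal_of_oneDoorAnalytic` on its load-bearing input: promoting AN-28 as THE child of 23715 loses nothing.
Per datum this is `bsdp_two_iff_doorLawFull_at` (`.mp`); the Heegner hypothesis for the door field follows from admissibility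
(`d_K ≡ 1 (8)`, `(d_K/ℓ) = 1` at the odd bad `ℓ`; tree `satisfiesHeegnerHypothesis_iff_kronecker`,
`dvd_conductorNorm_iff_not_hasGoodReductionAtPrime`). -/
theorem doorIndexLawFullAtTwo_of_crux (hpub : S_pub) (hZ : S_rankZeroTwin) (hcrux : RankOneAtTwoBigImageOddLocal) :
    DoorIndexLawFullAtTwo := by
  intro W _ _ _ hCM hsurj hT hc hr K _ _ hK hadm hLt Dt H ι P hP hcodd Wd _ _ Cd hWd
  haveI : Fact (Nat.Prime 2) := ⟨Nat.prime_two⟩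
  obtain ⟨hGZ, hKo, -⟩ := hpub.1 (W.conductorNorm ℤ) W K
  have hGZK : rank_eq_analyticRank_of_analyticRank_le_one := hpub.2.1
  have hmod : hasEntireLFunction_rat := hpub.2.2
  -- the Heegner hypothesis from door-admissibility
  have hHN : SatisfiesHeegnerHypothesis (W.conductorNorm ℤ) K := by
    rw [satisfiesHeegnerHypothesis_iff_kronecker (W.conductorNorm ℤ) K hK.1]
    intro p hp hpN
    refine ⟨fun _ => hadm.2.2.1, fun hp2 => hadm.2.2.2.2 p hp hp2 fun hF => ?_⟩
    haveI : Fact p.Prime := hF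
    exact (W.dvd_conductorNorm_iff_not_hasGoodReductionAtPrime p).mp hpN
  -- `BSD(Wd, 2)` from `S_rankZeroTwin`: the twist model is non-CM of analytic rank `0`
  have hd0 : (NumberField.discr K : ℚ) ≠ 0 := by exact_mod_cast NumberField.discr_ne_zero K
  haveI hEt : (W.quadraticTwist (NumberField.discr K : ℚ)).IsElliptic := W.isElliptic_quadraticTwist hd0
  have hLeq : Wd.entireLFunction = (W.quadraticTwist (NumberField.discr K : ℚ)).entireLFunction := by
    rw [← hWd, entireLFunction_smul]
  have hLd : Wd.entireLFunction 1 ≠ 0 := by rw [hLeq]; exact hLt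
  have hrd : Wd.analyticRank = 0 := (Wd.analyticRank_eq_zero_iff_holds (hmod Wd)).2 hLd
  have hCMd : ¬ Wd.HasCM := RamifiedPairUpperBound.not_hasCM_of_smul_quadraticTwist_eq hd0 hWd hCM
  have hBd : BSDp Wd 2 := hZ Wd hCMd hrd
  -- `BSD(W, 2)` from the crux, and the per-datum equivalence
  have hB : BSDp W 2 := hcrux W hCM hsurj hT hc hr
  exact (bsdp_two_iff_doorLawFull_at hGZK hmod stub_doorTamagawa W hT hc hr K hK hGZ hKo hadm hHN hLt Dt hcodd H ι P hP
    Wd Cd hWd hBd).2.2.mp hB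

/-- The same from the route's four rank-`0` cruxes BY NAME. -/
theorem doorIndexLawFullAtTwo_of_crux_of_rankZero_cruxes (hpub : S_pub)
    (hR0 : GoodOrdinaryRankZeroAtTwo ∧ MultiplicativeRankZeroAtTwo ∧ SupersingularRankZeroAtTwo ∧ AdditiveRankZeroAtTwo)
    (hcrux : RankOneAtTwoBigImageOddLocal) : DoorIndexLawFullAtTwo :=
  doorIndexLawFullAtTwo_of_crux hpub (rankZeroTwin_of_rankZero_cruxes hR0) hcrux

/-- **LOSSLESSNESS of the v8 split, by name**: modulo PRINT (`S_pub`, `S_pubHL`), the route's four rank-`0` cruxes and `S_manin`,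
the crux `RankOneAtTwoBigImageOddLocal` is EQUIVALENT to the one conjecture `DoorIndexLawFullAtTwo`. -/
theorem rankOneAtTwoBigImageOddLocal_iff_doorIndexLawFull (hpub : S_pub) (hHL : S_pubHL)
    (hR0 : GoodOrdinaryRankZeroAtTwo ∧ MultiplicativeRankZeroAtTwo ∧ SupersingularRankZeroAtTwo ∧ AdditiveRankZeroAtTwo)
    (hMan : S_manin) : RankOneAtTwoBigImageOddLocal ↔ DoorIndexLawFullAtTwo :=
  ⟨doorIndexLawFullAtTwo_of_crux_of_rankZero_cruxes hpub hR0,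
    fun hIdx => rankOneAtTwoBigImageOddLocal_of_oneDoorAnalytic hpub hHL hIdx hR0 hMan⟩

end Summit.BirchSwinnertonDyer.BirchSwinnertonDyer.Theorems.RankOneAtTwoOneDoor

end
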